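import Mathlib.LinearAlgebra.Dual.Defs
import Mathlib.LinearAlgebra.Isomorphisms
import Mathlib.LinearAlgebra.Prod
import Mathlib.Algebra.Module.Torsion.Basic
import Mathlib.RingTheory.Ideal.Span
import Mathlib.RingTheory.Ideal.Quotient.Defs
import Mathlib.LinearAlgebra.Quotient.Basic
import Mathlib.Tactic.LinearCombination
import Mathlib.Tactic.Ring
import HarnessLib

/-!
# CM-branch reduction of the `Λ`-dual of the Betina–Dimitrov weight-one CM Hecke algebras — case (C): the ring
# («Lemma T», kernel form: the torsion input of the `Sat-prop2` repair of BSTW Prop. 4.12; dual part in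
# `CMBranchDualReductionCaseC.lean`)

Pure commutative algebra, sorry-free, no new facts (every `def` has a body). Companion to
`IwasawaSaturationCriterion.lean` (same namespace; reader 1's **Lemma S**, p479383), whose hypothesis
`h2 : ∀ y ∈ torsion R (T ⧸ R∙t), ϖ • y = 0` is what **Lemma T** (`pub/bsd-litref/bstw24/sheets/
D-AUDIT-bstw24-r1-ADDENDUM-5.md` §2, sha16 73386cd869069474) supplies in the repair of the «it suffices» step of
Burungale–Skinner–Tian–Wan, arXiv:2409.01350v2, Part I, Prop. 4.12 (TeX l.3385–3388; PREPRINT), ruled PASS-in-cell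
WITH READER REPAIR at referee C4 ROUND C4-R3 (ε), where Lemma T was re-derived by hand in cases (C1)/(C2) and
checked «at argument level» in cases (gen)/(B). This file and its sequels `CMBranchDualReductionCaseC.lean` (dual, case (C)),
`CMBranchDualReductionCaseBRing.lean` + `CMBranchDualReductionCaseB.lean` (cases (gen)/(B)) make Lemma T a
KERNEL theorem in every printed case and for BOTH CM branches.

THE RINGS (printed): Betina–Dimitrov, Adv. Math. 384 (2021) 107724 = arXiv:1907.09422, Thm. 2
[corpus:paper:arxiv-1907.09422 p0003:L60–p0004:L3] = Thm. 4.8 [p0021:L68–L76]: the completed local ring of the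
eigencurve at the `p`-irregular weight-one CM point is `𝒯 ≅ Λ ×_k (𝒯^⊥ ×_{k[X]/(X^{r-1})} Λ)` (`Λ = Q̄_p⟦X⟧`,
`k = Q̄_p`; the two `Λ`'s are the CM components, the first projection is `π_ψ`), with (C) `r ≥ 3`,
`𝒯^⊥ = Λ[Z]/(Z² - X^r)`, `𝒯^⊥ ↠ k[X]/(X^{r-1})` = «modulo the non-principal ideal `(Z, X^{r-1})`»; (B) `r = 2`,
`𝒯^⊥ = k⟦X^{1/e}⟧ ×_k k⟦X^{1/e}⟧`, `e ≥ 2`; (gen) `r = 2`, `𝒯^⊥ = Λ ×_k Λ`.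
THIS FILE = case (C), over an ARBITRARY commutative ring `Λ` with a distinguished element `X`, `r = m + 2`
(`m : ℕ`), in the coordinates `(c₀, c_a, c_Z, c₁)` of the `Λ`-basis `w₀ = (1;1;1)`, `w_a = (X;0;0)`, `w_Z = (0;Z;0)`,
`w₁ = (0;X^{r-1};0)`: `BDRingC.mul` is the multiplication table; `ι`, `range_ι`, `ι_mul`, `ι_injective` CERTIFY
that `(Λ⁴, mul)` is BD's fibre product inside `Λ × Λ[Z]/(Z² - X^r) × Λ`; `pr₁`, `pr₂` are the two CM projections
(multiplicative: `pr₁_mul`, `pr₂_mul`).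
PROVED (kernel, in `…CaseC.lean`): with `ω := Hom_Λ(𝒯, Λ) = Module.Dual Λ (Λ⁴)`, `t·f := f ∘ₗ mulLeft t` (`(t·f)(s) = f(ts)`) and
`pOmega 𝔭 := span{t·f : t ∈ 𝔭}` (`= 𝔭ω`; `ω/𝔭ω = ω ⊗_𝒯 𝒯/𝔭`), for `𝔭 = ker pr₁` (C1) and `𝔭 = ker pr₂` (C2):
`ω ⧸ pOmega 𝔭 ≃ₗ[Λ] Λ/(X) × Λ/(X) × Λ` (`dualQuotEquiv₁/₂`: explicit comparison maps `φ₁/φ₂`, kernel `= 𝔭ω`,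
surjective — invariant factors `(1, X, X)` and free rank 1, as in ADD-5 §2 and C4-R3.2(d)(iii)); hence over a
domain `X • (ω/𝔭ω)_tors = 0` (`smul_eq_zero_of_mem_torsion₁/₂`), the exact shape of Lemma S's `h2`.
ON PAPER (neither formalised nor assumed): (i) that BD's completed local ring IS this algebra — transcription of
a refereed theorem [cite: BetinaDimitrov2021, Thm 2 / Thm 4.8]; (ii) BSTW's identification
`T⁻ = 𝐓̂⁻_P ⊗ R ≅ S ⊗_{𝓡⁰,φ_r} R` with `S ≃ Hom_{Q̄_p⟦X⟧}(𝓡⁰, Q̄_p⟦X⟧)` as `𝓡⁰`-modules (the duality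
`(HidaDu)`, TeX 5926f035551c636d l.3307–3308 and l.3332) and `𝓡⁰ = 𝒯^full = 𝒯` (l.3298–3301), «a description of `𝓡⁰`
is provided by [BD, Thm. B]» (l.3310) — i.e. `T⁻ ≅ ω_𝒯 ⊗_𝒯 𝒯/𝔭`; (iii) anything about modular forms. Typed ≠ endorsed; nothing here bears on a census cell.
See also `IwasawaSaturationCongruenceCriterion.lean` (reader 2's independent Lemma C for the same line).
-/

namespace Literature.NumberTheory.EllipticCurves.IwasawaTransfer

open Submodule Module
/-! ### The target shape `Λ/(X) × Λ/(X) × Λ` and its torsion -/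

section TargetShape

variable {Λ : Type*} [CommRing Λ]

/-- `X` kills every class of `Λ ⧸ (X)`.
[cite: BurungaleSkinnerTianWan2024, Part I Prop. 4.12 (proof l.3385–3388: the shape `Λ ⊕ k ⊕ k` of `T⁻` in Lemma T; PREPRINT)] -/
theorem smul_mkQ_span_singleton_self (X x : Λ) : X • (Ideal.span {X}).mkQ x = 0 := by
  rw [Submodule.mkQ_apply, ← Submodule.Quotient.mk_smul, Submodule.Quotient.mk_eq_zero, smul_eq_mul]
  exact Ideal.mul_mem_right _ _ (Ideal.mem_span_singleton_self X)

/-- Over a domain, the torsion of any module isomorphic to `Λ/(X) × Λ/(X) × Λ` is killed by `X`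
(for `X = 0` trivially; for `X ≠ 0` the torsion is the `k ⊕ k` part). This is the form in which
Lemma T feeds hypothesis `h2` of `torsionQuotient_mk_not_mem_smul_top` (Lemma S).
[cite: BurungaleSkinnerTianWan2024, Part I Prop. 4.12 (proof l.3385–3388: the shape `Λ ⊕ k ⊕ k` of `T⁻` in Lemma T; PREPRINT)] -/
theorem smul_eq_zero_of_mem_torsion_of_equiv [IsDomain Λ] (X : Λ) {M : Type*} [AddCommGroup M]
    [Module Λ M] (e : M ≃ₗ[Λ] (Λ ⧸ Ideal.span {X}) × (Λ ⧸ Ideal.span {X}) × Λ) {y : M}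
    (hy : y ∈ torsion Λ M) : X • y = 0 := by
  obtain ⟨⟨a, ha⟩, hay⟩ := (mem_torsion_iff y).mp hy
  have ha0 : a ≠ 0 := nonZeroDivisors.ne_zero ha
  simp only [Submonoid.mk_smul] at hay
  have hzero : a • e y = 0 := by rw [← map_smul, hay, map_zero]
  have h3 : (e y).2.2 = 0 := by
    have := congrArg (fun z => z.2.2) hzero
    simp only [Prod.smul_snd, smul_eq_mul, Prod.snd_zero, mul_eq_zero] at this
    exact this.resolve_left ha0
  apply e.injective
  rw [map_smul, map_zero]
  refine Prod.ext ?_ (Prod.ext ?_ ?_)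
  · obtain ⟨x, hx⟩ := (Ideal.span {X}).mkQ_surjective (e y).1
    rw [Prod.smul_fst, ← hx, Prod.fst_zero]; exact smul_mkQ_span_singleton_self X x
  · obtain ⟨x, hx⟩ := (Ideal.span {X}).mkQ_surjective (e y).2.1
    rw [Prod.smul_snd, Prod.smul_fst, ← hx, Prod.snd_zero, Prod.fst_zero]; exact smul_mkQ_span_singleton_self X x
  · rw [Prod.smul_snd, Prod.smul_snd, h3, smul_zero, Prod.snd_zero, Prod.snd_zero]

end TargetShape

/-! ### Case (C) of [BD, Thm 2 / Thm 4.8]: `𝒯 = Λ ×_k (Λ[Z]/(Z² - X^r) ×_{k[X]/(X^{r-1})} Λ)`, `r = m + 2` -/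

namespace BDRingC

variable {Λ : Type*} [CommRing Λ] (X : Λ) (m : ℕ)

/-- The multiplication of BD's ring in case (C), written in the coordinates `(c₀, c_a, c_Z, c₁)` of the
`Λ`-basis `w₀ = (1; 1; 1)`, `w_a = (X; 0; 0)`, `w_Z = (0; Z; 0)`, `w₁ = (0; X^(r-1); 0)` (`r = m + 2`):
`w₀` is the unit, `w_a² = X w_a`, `w_a w_Z = w_a w₁ = 0`, `w_Z² = X w₁`, `w_Z w₁ = X^(r-1) w_Z`,
`w₁² = X^(r-1) w₁`. [cite: BetinaDimitrov2021, Thm 2 (= Thm 4.8), case `𝓛_-(ψ_-^τ)·𝓛_-(ψ_-) = 0`] -/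
def mul (v w : Λ × Λ × Λ × Λ) : Λ × Λ × Λ × Λ :=
  (v.1 * w.1,
    v.1 * w.2.1 + v.2.1 * w.1 + X * v.2.1 * w.2.1,
    v.1 * w.2.2.1 + v.2.2.1 * w.1 + X ^ (m + 1) * (v.2.2.1 * w.2.2.2 + v.2.2.2 * w.2.2.1),
    v.1 * w.2.2.2 + v.2.2.2 * w.1 + X * v.2.2.1 * w.2.2.1 + X ^ (m + 1) * v.2.2.2 * w.2.2.2)

/-- Basis vector `w₀ = (1; 1; 1)` (the unit). [cite: BetinaDimitrov2021, Thm 2 (= Thm 4.8), case (C)] -/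
def w₀ : Λ × Λ × Λ × Λ := (1, 0, 0, 0)
/-- Basis vector `w_a = (X; 0; 0)`. [cite: BetinaDimitrov2021, Thm 2 (= Thm 4.8), case (C)] -/
def wa : Λ × Λ × Λ × Λ := (0, 1, 0, 0)
/-- Basis vector `w_Z = (0; Z; 0)`. [cite: BetinaDimitrov2021, Thm 2 (= Thm 4.8), case (C)] -/
def wZ : Λ × Λ × Λ × Λ := (0, 0, 1, 0)
/-- Basis vector `w₁ = (0; X^(r-1); 0)`. [cite: BetinaDimitrov2021, Thm 2 (= Thm 4.8), case (C)] -/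
def w₁ : Λ × Λ × Λ × Λ := (0, 0, 0, 1)

/-- BD's ring (case (C)) is commutative. [cite: BetinaDimitrov2021, Thm 2 (= Thm 4.8), case (C)] -/
theorem mul_comm' (v w : Λ × Λ × Λ × Λ) : mul X m v w = mul X m w v := by ext <;> simp only [mul] <;> ring

/-- BD's ring (case (C)) is associative. [cite: BetinaDimitrov2021, Thm 2 (= Thm 4.8), case (C)] -/
theorem mul_assoc' (u v w : Λ × Λ × Λ × Λ) : mul X m (mul X m u v) w = mul X m u (mul X m v w) := by
  ext <;> simp only [mul] <;> ring

/-- `w₀ = (1;1;1)` is the unit. [cite: BetinaDimitrov2021, Thm 2 (= Thm 4.8), case (C)] -/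
theorem mul_w₀ (v : Λ × Λ × Λ × Λ) : mul X m v w₀ = v := by ext <;> simp [mul, w₀]

/-- Left multiplication by `t`, as a `Λ`-linear map. [cite: BetinaDimitrov2021, Thm 2 (= Thm 4.8), case (C)] -/
def mulLeft (t : Λ × Λ × Λ × Λ) : (Λ × Λ × Λ × Λ) →ₗ[Λ] (Λ × Λ × Λ × Λ) where
  toFun := mul X m t
  map_add' v w := by ext <;> simp only [mul, Prod.fst_add, Prod.snd_add] <;> ring
  map_smul' c v := by
    ext <;> simp only [mul, Prod.smul_fst, Prod.smul_snd, smul_eq_mul, RingHom.id_apply] <;> ring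

/-- Unfolding `mulLeft`. [cite: BetinaDimitrov2021, Thm 2 (= Thm 4.8), case (C)] -/
@[simp] theorem mulLeft_apply (t v : Λ × Λ × Λ × Λ) : mulLeft X m t v = mul X m t v := rfl

/-! #### The presentation as BD's fibre product: `ι (c₀, c_a, c_Z, c₁) = (a₁; (a, b); d) :=
(c₀ + X c_a; (c₀ + X^(r-1) c₁, c_Z); c₀)` realises `(Λ⁴, mul)` as `{(a₁; a + bZ; d) : a₁ ≡ a (X), a ≡ d (X^(r-1))}`
inside `Λ × Λ[Z]/(Z² - X^r) × Λ` (middle factor in the basis `1, Z`: `(a+bZ)(a'+b'Z) = (aa'+X^r bb') + (ab'+a'b)Z`). -/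

/-- The ambient multiplication of `Λ × Λ[Z]/(Z² - X^r) × Λ` (`r = m + 2`), middle factor in the basis
`1, Z`. [cite: BetinaDimitrov2021, Thm 4.8] -/
def ambientMul (p q : Λ × (Λ × Λ) × Λ) : Λ × (Λ × Λ) × Λ :=
  (p.1 * q.1, (p.2.1.1 * q.2.1.1 + X ^ (m + 2) * p.2.1.2 * q.2.1.2, p.2.1.1 * q.2.1.2 + q.2.1.1 * p.2.1.2),
    p.2.2 * q.2.2)

/-- The coordinate embedding into `Λ × Λ[Z]/(Z² - X^r) × Λ`.
[cite: BetinaDimitrov2021, Thm 2 (= Thm 4.8), case (C)] -/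
def ι (v : Λ × Λ × Λ × Λ) : Λ × (Λ × Λ) × Λ :=
  (v.1 + X * v.2.1, (v.1 + X ^ (m + 1) * v.2.2.2, v.2.2.1), v.1)

/-- `ι` is multiplicative: the table `mul` IS the multiplication of BD's fibre product.
[cite: BetinaDimitrov2021, Thm 2 (= Thm 4.8), case (C)] -/
theorem ι_mul (v w : Λ × Λ × Λ × Λ) : ι X m (mul X m v w) = ambientMul X m (ι X m v) (ι X m w) := by
  ext <;> simp only [ι, mul, ambientMul] <;> ring

/-- The image of `ι` is exactly BD's fibre product: triples `(a₁; a + bZ; d)` with `a₁ ≡ a (mod X)` and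
`a ≡ d (mod X^(r-1))`. [cite: BetinaDimitrov2021, Thm 4.8 («the map `Λ[Z]/(Z²-X^r) ↠ Q̄_p[X]/(X^{r-1})` is
modulo the non-principal ideal `(Z, X^{r-1})`»)] -/
theorem range_ι : Set.range (ι X m) =
    {p : Λ × (Λ × Λ) × Λ | X ∣ p.1 - p.2.1.1 ∧ X ^ (m + 1) ∣ p.2.1.1 - p.2.2} := by
  ext p
  simp only [Set.mem_range, Set.mem_setOf_eq]
  constructor
  · rintro ⟨v, rfl⟩
    refine ⟨⟨v.2.1 - X ^ m * v.2.2.2, ?_⟩, ⟨v.2.2.2, ?_⟩⟩ <;> simp only [ι] <;> ring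
  · rintro ⟨⟨ca, hca⟩, ⟨c₁, hc₁⟩⟩
    refine ⟨(p.2.2, ca + X ^ m * c₁, p.2.1.2, c₁), ?_⟩
    refine Prod.ext ?_ (Prod.ext (Prod.ext ?_ rfl) rfl)
    · show p.2.2 + X * (ca + X ^ m * c₁) = p.1
      linear_combination -hca - hc₁
    · show p.2.2 + X ^ (m + 1) * c₁ = p.2.1.1
      linear_combination -hc₁

/-- `ι` is injective as soon as `X` is a non-zero-divisor (e.g. `Λ = Q̄_p⟦X⟧`).
[cite: BetinaDimitrov2021, Thm 2 (= Thm 4.8), case (C)] -/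
theorem ι_injective (hX : X ∈ nonZeroDivisors Λ) : Function.Injective (ι X m) := by
  intro v w h
  simp only [ι, Prod.mk.injEq] at h
  obtain ⟨h1, ⟨h2, h3⟩, h4⟩ := h
  have hXpow : X ^ (m + 1) ∈ nonZeroDivisors Λ := Submonoid.pow_mem _ hX _
  have ha : v.2.1 = w.2.1 := by
    have h0 : (v.2.1 - w.2.1) * X = 0 := by linear_combination h1 - h4
    exact sub_eq_zero.mp ((mem_nonZeroDivisors_iff.mp hX).2 _ h0)
  have h1' : v.2.2.2 = w.2.2.2 := by
    have h0 : (v.2.2.2 - w.2.2.2) * X ^ (m + 1) = 0 := by linear_combination h2 - h4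
    exact sub_eq_zero.mp ((mem_nonZeroDivisors_iff.mp hXpow).2 _ h0)
  exact Prod.ext h4 (Prod.ext ha (Prod.ext h3 h1'))

/-- The projection onto the FIRST factor `Λ` (BD: `π_ψ`, the `Θ_ψ` branch): `(c₀,c_a,c_Z,c₁) ↦ a₁ = c₀ + X c_a`.
[cite: BetinaDimitrov2021, Thm 2 (= Thm 4.8), case (C)] -/
def pr₁ : (Λ × Λ × Λ × Λ) →ₗ[Λ] Λ where
  toFun v := v.1 + X * v.2.1
  map_add' v w := by simp only [Prod.fst_add, Prod.snd_add]; ring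
  map_smul' c v := by simp only [Prod.smul_fst, Prod.smul_snd, smul_eq_mul, RingHom.id_apply]; ring

/-- The projection onto the INNER factor `Λ` (the `Θ_{ψ^τ}` branch): `(c₀,c_a,c_Z,c₁) ↦ d = c₀`.
[cite: BetinaDimitrov2021, Thm 2 (= Thm 4.8), case (C)] -/
def pr₂ : (Λ × Λ × Λ × Λ) →ₗ[Λ] Λ := LinearMap.fst Λ Λ (Λ × Λ × Λ)

/-- Unfolding `pr₁`. [cite: BetinaDimitrov2021, Thm 2 (= Thm 4.8), case (C)] -/
@[simp] theorem pr₁_apply (v : Λ × Λ × Λ × Λ) : pr₁ X v = v.1 + X * v.2.1 := rfl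
/-- Unfolding `pr₂`. [cite: BetinaDimitrov2021, Thm 2 (= Thm 4.8), case (C)] -/
@[simp] theorem pr₂_apply (v : Λ × Λ × Λ × Λ) : (pr₂ : (Λ × Λ × Λ × Λ) →ₗ[Λ] Λ) v = v.1 := rfl

/-- `pr₁ = π_ψ` is multiplicative (a ring map onto the first factor `Λ`).
[cite: BetinaDimitrov2021, Thm 2 (= Thm 4.8), case (C)] -/
theorem pr₁_mul (v w : Λ × Λ × Λ × Λ) : pr₁ X (mul X m v w) = pr₁ X v * pr₁ X w := by
  simp only [pr₁_apply, mul]; ring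

/-- `pr₂` is multiplicative (a ring map onto the inner factor `Λ`).
[cite: BetinaDimitrov2021, Thm 2 (= Thm 4.8), case (C)] -/
theorem pr₂_mul (v w : Λ × Λ × Λ × Λ) :
    (pr₂ : (Λ × Λ × Λ × Λ) →ₗ[Λ] Λ) (mul X m v w) = (pr₂ : _ →ₗ[Λ] Λ) v * (pr₂ : _ →ₗ[Λ] Λ) w := by
  simp only [pr₂_apply, mul]

/-- `pr₁` is the first coordinate of `ι`. [cite: BetinaDimitrov2021, Thm 2 (= Thm 4.8), case (C)] -/
theorem pr₁_eq_ι_fst (v : Λ × Λ × Λ × Λ) : pr₁ X v = (ι X m v).1 := rfl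
/-- `pr₂` is the last coordinate of `ι`. [cite: BetinaDimitrov2021, Thm 2 (= Thm 4.8), case (C)] -/
theorem pr₂_eq_ι_snd_snd (v : Λ × Λ × Λ × Λ) : (pr₂ : _ →ₗ[Λ] Λ) v = (ι X m v).2.2 := rfl

/-- Products with `w_a`: `t·w_a = (c₀ + X c_a) w_a`. [cite: BetinaDimitrov2021, Thm 2 (= Thm 4.8), case (C)] -/
theorem mul_wa (t : Λ × Λ × Λ × Λ) : mul X m t wa = (0, t.1 + X * t.2.1, 0, 0) := by ext <;> simp [mul, wa]

/-- Products with `w_Z`. [cite: BetinaDimitrov2021, Thm 2 (= Thm 4.8), case (C)] -/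
theorem mul_wZ (t : Λ × Λ × Λ × Λ) : mul X m t wZ = (0, 0, t.1 + X ^ (m + 1) * t.2.2.2, X * t.2.2.1) := by
  ext <;> simp [mul, wZ]

/-- Products with `w₁`. [cite: BetinaDimitrov2021, Thm 2 (= Thm 4.8), case (C)] -/
theorem mul_w₁ (t : Λ × Λ × Λ × Λ) : mul X m t w₁ = (0, 0, X ^ (m + 1) * t.2.2.1, t.1 + X ^ (m + 1) * t.2.2.2) := by
  ext <;> simp [mul, w₁]

end BDRingC

end Literature.NumberTheory.EllipticCurves.IwasawaTransfer
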